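import Summits.HodgeConjecture.HodgeConjecture.Theses.HeckePrymWeil
import Literature.AlgebraicGeometry.Motives.HyperbolicWeilType
import Literature.AlgebraicGeometry.Motives.AbelianVarietyProduct

/-!
# Sketch — crux-ideate round 1, ideator k = 2, crux `WeilTwelvefoldsSqrtMinus7` (stmt-HodgeConjecture-1261)

First lemmas of the two idea cards (statements only; they must elaborate):

* card `canonical-level-theta-cycles`: `DisjointPairCertificate` — on a Weil-generic
  `ℚ(√-7)`-Weil 12-fold two ALGEBRAIC middle classes `z₁, z₂` with `z₁ ⌣ z₂ = 0` and
  `zᵢ ⌣ h⁶ ≠ 0` force the Weil plane `E₊ ⊔ E₋` (the crux's typing, `(𝟙+φ)^* = (2π)^*`,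
  `π = (1+√-7)/2`) into `algebraicClasses A.X 6`. Pure linear algebra on the real carriers given
  Weil-genericity (`B⁶ ⊗ ℂ = ℂ h⁶ ⊕ E₊ ⊕ E₋`, Weil 1977 / van Geemen 4.11, 6.12) as a hypothesis.
* card `secant-designs-cm-anchor`: `HyperbolicTwelvefoldsSqrtMinus7` — the hyperbolic-component
  case of the crux (typed with the tree's `Motives.IsHyperbolicWeilType`), the direct target of the
  `n = 6` design; and `AimedDescentFourteen` — the crux from the hyperbolic 14-fold statement
  restricted to products with a Weil surface (all discriminants).
-/

noncomputable section

open CategoryTheory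
open Literature.AlgebraicGeometry
open Literature.AlgebraicGeometry.HodgeTheory
open Literature.AlgebraicTopology.SingularHomology

namespace Summit.HodgeConjecture.HodgeConjecture.Cruxes.WeilTwelvefoldsSqrtMinus7.IdeatorTwo

/-- `(𝟙 + φ)^*` on `H¹²(A(ℂ); ℂ)` — for `φ = √-7` this is `(2π)^*`, `π = (1+√-7)/2` of norm `2`. -/
abbrev T (A : Motives.AbelianVariety ℂ) (φ : A ⟶ A) :
    complexBetti A.X 12 →ₗ[ℂ] complexBetti A.X 12 :=
  (complexBetti.map (𝟙 A + φ).hom.hom.hom 12).hom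

/-- The `+` Weil eigenline of the crux's typing. -/
abbrev Eplus (A : Motives.AbelianVariety ℂ) (φ : A ⟶ A) : Submodule ℂ (complexBetti A.X 12) :=
  Module.End.eigenspace (T A φ) ((1 + Complex.I * (Real.sqrt (7 : ℝ) : ℂ)) ^ 12)

/-- The `-` Weil eigenline of the crux's typing. -/
abbrev Eminus (A : Motives.AbelianVariety ℂ) (φ : A ⟶ A) : Submodule ℂ (complexBetti A.X 12) :=
  Module.End.eigenspace (T A φ) ((1 - Complex.I * (Real.sqrt (7 : ℝ) : ℂ)) ^ 12)

/-- **Disjoint-pair certificate** (first lemma of card `canonical-level-theta-cycles`).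
For a `ℚ(√-7)`-Weil 12-fold `(A, φ)` which is WEIL-GENERIC — every rational `(6,6)`-class is
`t • h⁶` plus a Weil class, `h⁶` an algebraic rational class with `(𝟙+φ)^* h⁶ = 8⁶ h⁶` (the sixth
power of a Weil-compatible polarization: `(1+i√7)⁶(1-i√7)⁶ = 8⁶`) — and on which `(𝟙+φ)^*`
preserves algebraic classes (pull-back along the isogeny `2π`), two rational ALGEBRAIC classes
`z₁, z₂ ∈ H¹²` with `z₁ ⌣ z₂ = 0` (e.g. classes of DISJOINT effective 6-cycles) and `zᵢ ⌣ h⁶ ≠ 0`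
make every rational `(6,6)`-class of the Weil plane algebraic: writing `zᵢ = aᵢ h⁶ + wᵢ`,
`aᵢ ≠ 0` and `w₁ ⌣ w₂ = -a₁a₂ h¹² ≠ 0`, so `w₁ = z₁ - a₁h⁶ ≠ 0` is algebraic, real, hence has
non-zero components on both eigenlines, and `w₁, (𝟙+φ)^* w₁` span `E₊ ⊕ E₋`. -/
def DisjointPairCertificate : Prop :=
  ∀ (A : Motives.AbelianVariety ℂ) (φ : A ⟶ A) (h6 z₁ z₂ : complexBetti A.X 12),
    A.dim = 12 → φ ≫ φ = -((7 : ℤ) • 𝟙 A) →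
    -- `(𝟙+φ)^*` preserves algebraic classes
    (∀ x ∈ algebraicClasses A.X 6, T A φ x ∈ algebraicClasses A.X 6) →
    -- `h⁶`: rational, algebraic, eigenvalue `8⁶`
    IsRationalClass h6 → h6 ∈ algebraicClasses A.X 6 → T A φ h6 = ((8 : ℂ) ^ 6) • h6 →
    -- Weil-genericity (Weil 1977): rational `(6,6)`-classes are `ℂ h⁶ ⊕ E₊ ⊕ E₋`
    (∀ c : complexBetti A.X 12, IsRationalClass c → IsOfHodgeType 12 A.X 12 6 6 c →
      ∃ t : ℂ, c - t • h6 ∈ Eplus A φ ⊔ Eminus A φ) →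
    -- the certificate: two algebraic rational classes, mutually orthogonal, not orthogonal to `h⁶`
    IsRationalClass z₁ → IsRationalClass z₂ →
    z₁ ∈ algebraicClasses A.X 6 → z₂ ∈ algebraicClasses A.X 6 →
    cupProduct (rfl : 12 + 12 = 24) z₁ z₂ = 0 →
    cupProduct (rfl : 12 + 12 = 24) z₁ h6 ≠ 0 → cupProduct (rfl : 12 + 12 = 24) z₂ h6 ≠ 0 →
    ∀ c : complexBetti A.X 12, IsRationalClass c → IsOfHodgeType 12 A.X 12 6 6 c →
      c ∈ Eplus A φ ⊔ Eminus A φ → c ∈ algebraicClasses A.X 6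

/-- The certificate closes the crux pointwise: if on EVERY `(A, φ)` of the crux some pair
`(z₁, z₂)` as above exists (uniform theta construction + one charged instance), the crux follows.
(Statement of the composition; `h6`, genericity and `T`-stability are to be supplied per `A`.) -/
def certificate_closes : Prop :=
  DisjointPairCertificate →
    (∀ (A : Motives.AbelianVariety ℂ) (φ : A ⟶ A), A.dim = 12 → φ ≫ φ = -((7 : ℤ) • 𝟙 A) →
      ∃ h6 z₁ z₂ : complexBetti A.X 12,
        (∀ x ∈ algebraicClasses A.X 6, T A φ x ∈ algebraicClasses A.X 6) ∧
        IsRationalClass h6 ∧ h6 ∈ algebraicClasses A.X 6 ∧ T A φ h6 = ((8 : ℂ) ^ 6) • h6 ∧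
        (∀ c : complexBetti A.X 12, IsRationalClass c → IsOfHodgeType 12 A.X 12 6 6 c →
          ∃ t : ℂ, c - t • h6 ∈ Eplus A φ ⊔ Eminus A φ) ∧
        IsRationalClass z₁ ∧ IsRationalClass z₂ ∧
        z₁ ∈ algebraicClasses A.X 6 ∧ z₂ ∈ algebraicClasses A.X 6 ∧
        cupProduct (rfl : 12 + 12 = 24) z₁ z₂ = 0 ∧
        cupProduct (rfl : 12 + 12 = 24) z₁ h6 ≠ 0 ∧ cupProduct (rfl : 12 + 12 = 24) z₂ h6 ≠ 0) →
    Summit.HodgeConjecture.HodgeConjecture.Theses.HeckePrymWeil.WeilTwelvefoldsSqrtMinus7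

/-- The composition is pure logic (the Weil-generic case; non-generic members are reached in the
card by flatness/specialisation, not by this lemma). -/
theorem certificate_closes_holds : certificate_closes := by
  intro hcert hsupply A φ hdim hφ c hc hH hmem
  obtain ⟨h6, z₁, z₂, hT, h6r, h6a, h6e, hgen, z1r, z2r, z1a, z2a, h12, h1, h2⟩ :=
    hsupply A φ hdim hφ
  exact hcert A φ h6 z₁ z₂ hdim hφ hT h6r h6a h6e hgen z1r z2r z1a z2a h12 h1 h2 c hc hH hmem

/-- **Hyperbolic case of the crux** (first deliverable of card `secant-designs-cm-anchor`): the Weil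
classes are algebraic on every `ℚ(√-7)`-Weil 12-fold carrying a rational Weil-compatible class
`h ∈ H²` (`φ^* h = 7 h`) for which `(A, φ)` is of HYPERBOLIC Weil type (`det H = (-1)⁶ = 1`; the
component containing the anchors `X ⊗ O_K`, `E_K⁶ × Ê_K⁶` and Markman-type `X × X̂`). -/
def HyperbolicTwelvefoldsSqrtMinus7 : Prop :=
  ∀ (A : Motives.AbelianVariety ℂ) (φ : A ⟶ A) (h : complexBetti A.X 2),
    A.dim = 12 → φ ≫ φ = -((7 : ℤ) • 𝟙 A) →
    IsRationalClass h → complexBetti.map φ.hom.hom.hom 2 h = (7 : ℂ) • h →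
    Motives.IsHyperbolicWeilType A φ 6 h →
    ∀ c : complexBetti A.X 12, IsRationalClass c → IsOfHodgeType 12 A.X 12 6 6 c →
      c ∈ Eplus A φ ⊔ Eminus A φ → c ∈ algebraicClasses A.X 6

/-- `HyperbolicTwelvefoldsSqrtMinus7` is an instance of the crux (sanity: the design target is not
stronger than the crux). -/
theorem hyperbolic_of_crux :
    Summit.HodgeConjecture.HodgeConjecture.Theses.HeckePrymWeil.WeilTwelvefoldsSqrtMinus7 →
      HyperbolicTwelvefoldsSqrtMinus7 := by
  intro h A φ hh hdim hφ _ _ _ c hc hH hmem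
  exact h A φ hdim hφ c hc hH hmem

set_option maxHeartbeats 1000000 in
/-- **Hyperbolic products one rung up** (the all-discriminant transfer of card
`secant-designs-cm-anchor`, shape of the sibling crux's `AimedDescent` at `m = 7`): Weil classes are
algebraic on the 14-folds `A × B`, `B` a `ℚ(√-7)`-Weil SURFACE, with the diagonal `K`-action. In print
one takes `B = B_{-δ}` so that `A × B` is HYPERBOLIC (`δ·(-δ) ≡ -1 = (-1)⁷`), the component with the
design anchors `E_K⁷ × Ê_K⁷`; the typed shape quantifies over all `B` (a slightly stronger HC instance)
to stay on real carriers. -/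
def HyperbolicProductFourteenfolds : Prop :=
  ∀ (A : Motives.AbelianVariety ℂ) (φ : A ⟶ A) (B : Motives.AbelianVariety ℂ) (ψ : B ⟶ B),
    A.dim = 12 → B.dim = 2 → φ ≫ φ = -((7 : ℤ) • 𝟙 A) → ψ ≫ ψ = -((7 : ℤ) • 𝟙 B) →
    ∀ c : complexBetti (A.prod B).X (2 * 7), IsRationalClass c →
      IsOfHodgeType 14 (A.prod B).X (2 * 7) 7 7 c →
      c ∈ Module.End.eigenspace
            (complexBetti.map
              (𝟙 (A.prod B) + Motives.AbelianVariety.prodLift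
                (Motives.AbelianVariety.fst A B ≫ φ) (Motives.AbelianVariety.snd A B ≫ ψ)).hom.hom.hom
              (2 * 7)).hom ((1 + Complex.I * (Real.sqrt (7 : ℝ) : ℂ)) ^ 14) ⊔
          Module.End.eigenspace
            (complexBetti.map
              (𝟙 (A.prod B) + Motives.AbelianVariety.prodLift
                (Motives.AbelianVariety.fst A B ≫ φ) (Motives.AbelianVariety.snd A B ≫ ψ)).hom.hom.hom
              (2 * 7)).hom ((1 - Complex.I * (Real.sqrt (7 : ℝ) : ℂ)) ^ 14) →
      c ∈ algebraicClasses (A.prod B).X 7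

/-- The aimed descent `14 → 12` (Koike / Schoen §10 / Markman; the route's `WeilDescending` at
`m = 7` cut down to products): statement only — its proof needs Künneth for `complexBetti` of
`A.prod B` and a push-forward preserving `algebraicClasses`, the same infrastructure gap as item
stmt-HodgeConjecture-1263. -/
def AimedDescentFourteen : Prop :=
  HyperbolicProductFourteenfolds →
    Summit.HodgeConjecture.HodgeConjecture.Theses.HeckePrymWeil.WeilTwelvefoldsSqrtMinus7

end Summit.HodgeConjecture.HodgeConjecture.Cruxes.WeilTwelvefoldsSqrtMinus7.IdeatorTwo
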